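import Summits.HubbardSuperconductivity.HubbardSuperconductivity.Theorems.BalabanIRBirSliceXYOrderRPFourier
import Summits.HubbardSuperconductivity.HubbardSuperconductivity.Theorems.BalabanIRBirSliceXYOrderRPSums
import Summits.HubbardSuperconductivity.HubbardSuperconductivity.Theses.BalabanIR
import Literature.Probability.LatticeModels.PlaneRotatorLROProofs
import HarnessLib

/-!
# Slice order of the anisotropic XY torus (route BalabanIR, support item `BirSliceXYOrderRP`):
# VI. Assembly — `BirSliceXYOrderRP` proved

Final file of the proof of
`Summit.HubbardSuperconductivity.HubbardSuperconductivity.Theses.BalabanIR.BirSliceXYOrderRP`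
(item stmt-HubbardSuperconductivity-2084): for the classical nearest-neighbour XY model on the
anisotropic torus `(ℤ/L)² × (ℤ/M)` with weight
`exp(K ∑_s [cos(θ_s - θ_{s+e₁}) + cos(θ_s - θ_{s+e₂}) + cos(θ_s - θ_{s+e_τ})])`, there are `K₀, L₀`
(here `K₀ = 128`, `L₀ = 4`) with: `K ≥ K₀`, `L₀ ≤ L ≤ M`, `L, M` even ⇒
`⟨|L⁻² ∑_x e^{iθ(x,0)}|²⟩ ≥ 1/2` — equal-time slice order, uniformly in `M ≥ L` (including `M ≫ L²`).

Proof route (Fröhlich–Simon–Spencer 1976; Friedli–Velenik 2017 §10.5, Thm. 10.24 and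
(10.39)–(10.41)), carried out on the relabelled torus `Λ = (ℤ/L)² × (ℤ/M)¹`, the box product of two
of the tree's cubic torus graphs:
* files I–II: the bond reflections of either factor lift to `Λ` with the hypotheses of the tree's
  reflection-positivity lemma `NVector.vZ_sq_le_reflect`; Gaussian domination `Z(h) ≤ Z(0)` by
  descent on bad bonds;
* file III: plane waves `χ_{k,q}(x,t) = χ_k(x)χ_q(t)` and the infrared bound per mode,
  `4βε(k,q) ∫ w|ω̂^a(k,q)|² ≤ |Λ| Z₀`, `ε(k,q) = ∑ᵢ(1 - cos 2πkᵢ/L) + (1 - cos 2πq/M)`;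
* file IV: Plancherel on `Λ`, the slice sum rule `M ∑_t |∑_x z_{(x,t)}|² = |Λ|² - ∑_{k≠0,q}|ẑ(k,q)|²`
  (only modes with nonzero SPATIAL momentum enter), slice-translation invariance, whence
  `M² ∫ w|∑_x z_{(x,0)}|² ≥ |Λ|²Z₀ - (|Λ|Z₀/β)∑_{k≠0,q} ε(k,q)⁻¹`;
* file V: `∑_{k≠0,q} ε(k,q)⁻¹ ≤ 32 L² M` for `L ≤ M`;
* this file: the angle/unit-vector dictionary (`β = K/2`, the XY weight is `e^{3|Λ|K}` times the
  Boltzmann weight of `(K/2)∑‖S_i - S_j‖²`, as in the tree's `PlaneRotator` treatment of FV Example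
  10.22), the relabelling `ℤ/M ≃ (ℤ/M)¹` of the angle cube (measure-preserving), and the arithmetic
  `defect ≤ 64/K ≤ 1/2`.

## References
* J. Fröhlich, B. Simon, T. Spencer, *Infrared bounds, phase transitions and continuous symmetry
  breaking*, Comm. Math. Phys. 50 (1976) 79–95, Thm. 3.1. [FrohlichSimonSpencer1976]
* S. Friedli, Y. Velenik, *Statistical Mechanics of Lattice Systems*, CUP 2017, §10.5
  (Example 10.22, Thm. 10.24, (10.39)–(10.41), Prop. 10.27). [FriedliVelenik2017]
* F. J. Dyson, E. H. Lieb, B. Simon, J. Stat. Phys. 18 (1978) 335–383. [DysonLiebSimon1978]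
-/

noncomputable section

namespace Summit.HubbardSuperconductivity.HubbardSuperconductivity.Theses.BalabanIR

open scoped BigOperators Topology Manifold Classical MeasureTheory ProbabilityTheory Matrix InnerProductSpace ComplexConjugate ContinuousMap
open Filter Set Function TopologicalSpace MeasureTheory

/-- **Record of the replaced/dropped route item `BirSliceXYOrderRP`** = stmt-HubbardSuperconductivity-2084 (ledger signature verbatim, in
the route file's namespace and `open` context; NOT a route item): after `birSliceXYOrderRP_proof` (below) closed the
item `proved` at 9a00f4d70212, the route repair (`restate` under a new name, or `drop`) removed
this constant from the gate-written Theses file, while the Theorems file below — append-only,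
statement text fixed — still names it ("Unknown identifier" in the full builds of 2026-08-16).
Re-declared here under its original fully-qualified name and definiens solely so that this record
keeps elaborating. TRUE (proved below). -/
def BirSliceXYOrderRP : Prop :=
  ∃ K₀ : ℝ, ∃ L₀ : ℕ, ∀ K : ℝ, K₀ ≤ K → ∀ (L M : ℕ) [NeZero L] [NeZero M], L₀ ≤ L → L ≤ M → Even L → Even M → let E : ((Literature.Probability.LatticeModels.TorusSite 2 L × ZMod M) → ℝ) → ℝ := fun θ => ∑ s : (Literature.Probability.LatticeModels.TorusSite 2 L × ZMod M), (Real.cos (θ s - θ (s.1 + ![1, 0], s.2)) + Real.cos (θ s - θ (s.1 + ![0, 1], s.2)) + Real.cos (θ s - θ (s.1, s.2 + 1))); let cube : Set ((Literature.Probability.LatticeModels.TorusSite 2 L × ZMod M) → ℝ) := Set.pi Set.univ (fun _ => Set.Icc (0:ℝ) (2 * Real.pi)); let Z : ℝ := MeasureTheory.integral (MeasureTheory.volume.restrict cube) (fun θ => Real.exp (K * E θ)); let O : ((Literature.Probability.LatticeModels.TorusSite 2 L × ZMod M) → ℝ) → ℝ := fun θ => ‖∑ x : Literature.Probability.LatticeModels.TorusSite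 2 L, Complex.exp (Complex.I * (θ (x, 0) : ℂ))‖ ^ 2 / (L : ℝ) ^ 4; (1/2 : ℝ) ≤ MeasureTheory.integral (MeasureTheory.volume.restrict cube) (fun θ => O θ * Real.exp (K * E θ)) / Z

end Summit.HubbardSuperconductivity.HubbardSuperconductivity.Theses.BalabanIR

namespace Summit.HubbardSuperconductivity.HubbardSuperconductivity.Theorems

namespace BirSliceXY

open Finset Literature.Probability.LatticeModels

/-! ### From angles to unit vectors, and from `(ℤ/L)² × ℤ/M` to `(ℤ/L)² × (ℤ/M)¹` -/

section Assembly

open _root_.Complex MeasureTheory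
open scoped ComplexConjugate

/-- **Relabelling the angle cube**: for an equivalence of finite index types `eq : κ ≃ ι`,
`∫_{[a,b]^ι} g(θ ∘ eq) dθ = ∫_{[a,b]^κ} g(θ') dθ'` (Lebesgue measure on the cube is invariant under
relabelling of coordinates, Mathlib's `volume_measurePreserving_piCongrLeft`). [folklore] -/
theorem setIntegral_cube_comp {ι κ : Type*} [Fintype ι] [Fintype κ] (eq : κ ≃ ι)
    (g : (κ → ℝ) → ℝ) (a b : ℝ) :
    ∫ θ in Set.pi Set.univ (fun _ : ι => Set.Icc a b), g (fun k => θ (eq k)) =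
      ∫ θ in Set.pi Set.univ (fun _ : κ => Set.Icc a b), g θ := by
  set F : (ι → ℝ) ≃ᵐ (κ → ℝ) := (MeasurableEquiv.piCongrLeft (fun _ : ι => ℝ) eq).symm with hF
  have hFm : MeasurePreserving F volume volume :=
    (volume_measurePreserving_piCongrLeft (fun _ : ι => ℝ) eq).symm _
  have hFapp : ∀ θ : ι → ℝ, F θ = fun k => θ (eq k) := by
    intro θ
    funext k
    rw [hF, ← MeasurableEquiv.coe_toEquiv_symm, MeasurableEquiv.piCongrLeft]
    simp only [Equiv.piCongrLeft_symm_apply]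
  have hpre : F ⁻¹' (Set.pi Set.univ fun _ : κ => Set.Icc a b) =
      Set.pi Set.univ fun _ : ι => Set.Icc a b := by
    ext θ
    simp only [Set.mem_preimage, Set.mem_pi, Set.mem_univ, true_implies, hFapp]
    exact ⟨fun h i => by simpa using h (eq.symm i), fun h k => h (eq k)⟩
  have h := hFm.setIntegral_preimage_emb F.measurableEmbedding g
    (Set.pi Set.univ fun _ : κ => Set.Icc a b)
  rw [hpre] at h
  simp_rw [hFapp] at h
  exact h

/-- **Change of variables from the angle cube to the product of single-spin laws** (the tree's
`PlaneRotator.integral_nVectorRef_map_angleLaw` for an arbitrary finite index set):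
`∫ F d(⊗_x u_*Leb|_{[0,2π]}) = ∫_{[0,2π]^Λ} F((u(θ_x))_x) dθ` for continuous `F`, `u`. [folklore] -/
theorem integral_pi_map_angleLaw {Λ : Type*} [Fintype Λ] {ν : ℕ} {u : ℝ → Fin ν → ℝ}
    (hu : Continuous u) (F : (Λ → Fin ν → ℝ) → ℝ) (hF : Continuous F) :
    ∫ ω, F ω ∂(Measure.pi fun _ : Λ =>
        Measure.map u (volume.restrict (Set.Icc (0 : ℝ) (2 * Real.pi)))) =
      ∫ θ in Set.pi Set.univ (fun _ : Λ => Set.Icc (0 : ℝ) (2 * Real.pi)), F fun x => u (θ x) := by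
  have hpi : (Measure.pi fun _ : Λ =>
      Measure.map u (volume.restrict (Set.Icc (0 : ℝ) (2 * Real.pi)))) =
      ((volume : Measure (Λ → ℝ)).restrict
          (Set.pi Set.univ fun _ => Set.Icc (0 : ℝ) (2 * Real.pi))).map fun θ x => u (θ x) := by
    rw [volume_pi, Measure.restrict_pi_pi, Measure.pi_map_pi fun _ => hu.measurable.aemeasurable]
  rw [hpi]
  have hc : Continuous fun (θ : Λ → ℝ) (x : Λ) => u (θ x) :=
    continuous_pi fun x => hu.comp (continuous_apply x)
  exact integral_map hc.measurable.aemeasurable hF.aestronglyMeasurable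

variable {L M : ℕ}

/-- `e₀ = (1,0)` and `e₁ = (0,1)` on `(ℤ/L)²`. [folklore] -/
theorem single_fin_two :
    (Pi.single (0 : Fin 2) (1 : ZMod L) : TorusSite 2 L) = ![1, 0] ∧
      (Pi.single (1 : Fin 2) (1 : ZMod L) : TorusSite 2 L) = ![0, 1] := by
  constructor <;> (ext i; fin_cases i <;> simp)

/-- **The XY energy is the bond energy of the unit vectors** on the product torus
`(ℤ/L)² × (ℤ/M)¹` (`L, M ≥ 3`): `𝓔((cos θ, sin θ)) = 6|Λ| - 2 ∑_p ∑_{3 directions} cos(θ_p - θ_{p+e})`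
(Friedli–Velenik 2017, Example 10.22: `‖S_i - S_j‖² = 2 - 2cos(θ_i - θ_j)`). [cite: FriedliVelenik2017, §10.5.1 Example 10.22] -/
theorem vecGradForm_cosSin_box [NeZero L] [NeZero M] [DecidableRel (torusGraph 2 L □ torusGraph 1 M).Adj] (hL : 3 ≤ L)
    (hM : 3 ≤ M) (θ : TorusSite 2 L × TorusSite 1 M → ℝ) :
    NVector.vecGradForm (torusGraph 2 L □ torusGraph 1 M)
        (fun p => (![Real.cos (θ p), Real.sin (θ p)] : Fin 2 → ℝ))
        (fun p => (![Real.cos (θ p), Real.sin (θ p)] : Fin 2 → ℝ)) =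
      6 * ((L : ℝ) ^ 2 * (M : ℝ)) -
        2 * ∑ p : TorusSite 2 L × TorusSite 1 M,
          (Real.cos (θ p - θ (p.1 + ![1, 0], p.2)) + Real.cos (θ p - θ (p.1 + ![0, 1], p.2)) +
            Real.cos (θ p - θ (p.1, p.2 + Pi.single 0 1))) := by
  rw [NVector.vecGradForm_eq_sum, sum_edgeFinset_boxTorus hL hM]
  simp only [Sym2.lift_mk, ← pow_two]
  simp only [PlaneRotator.sum_cosSin_sub_sq]
  simp only [Fin.sum_univ_two, Fintype.sum_unique, Fin.default_eq_zero, single_fin_two.1,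
    single_fin_two.2]
  have hcard : ((Fintype.card (TorusSite 2 L × TorusSite 1 M) : ℕ) : ℝ) = (L : ℝ) ^ 2 * M := by
    rw [card_boxTorus_real, pow_one]
  have h6 : (6 : ℝ) * ((L : ℝ) ^ 2 * M) = ∑ _p : TorusSite 2 L × TorusSite 1 M, (6 : ℝ) := by
    rw [Finset.sum_const, Finset.card_univ, nsmul_eq_mul, hcard, mul_comm]
  rw [Finset.mul_sum, h6, ← Finset.sum_sub_distrib]
  refine Finset.sum_congr rfl fun p _ => ?_
  ring

/-- `|∑_x e^{iθ_{(x,t)}}|² = |∑_x (cos θ_{(x,t)} + i sin θ_{(x,t)})|²` in the coordinates of the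
unit vectors. [folklore] -/
theorem norm_sq_sliceSum_cosSin [NeZero L] (θ : TorusSite 2 L × TorusSite 1 M → ℝ)
    (t : TorusSite 1 M) :
    ‖∑ x : TorusSite 2 L, Complex.exp (I * (θ (x, t) : ℂ))‖ ^ 2 =
      ‖∑ x : TorusSite 2 L, ((((![Real.cos (θ (x, t)), Real.sin (θ (x, t))] : Fin 2 → ℝ) 0 : ℝ) : ℂ) +
        (((![Real.cos (θ (x, t)), Real.sin (θ (x, t))] : Fin 2 → ℝ) 1 : ℝ) : ℂ) * I)‖ ^ 2 := by
  congr 2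
  refine Finset.sum_congr rfl fun x _ => ?_
  simp only [Matrix.cons_val_zero, Matrix.cons_val_one, Matrix.cons_val_fin_one]
  rw [mul_comm, Complex.exp_mul_I, Complex.ofReal_cos, Complex.ofReal_sin]

end Assembly

end BirSliceXY

open MeasureTheory BirSliceXY Literature.Probability.LatticeModels
open Summit.HubbardSuperconductivity.HubbardSuperconductivity.Theses.BalabanIR

/-- **Support item `BirSliceXYOrderRP` of route BalabanIR, proved** (calibration of the engine's
functional in the real case): for the classical nearest-neighbour XY model on the anisotropic torus
`(ℤ/L)² × (ℤ/M)` with weight `exp(K ∑_s [cos(θ_s - θ_{s+e₁}) + cos(θ_s - θ_{s+e₂}) + cos(θ_s - θ_{s+e_τ})])`,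
`K ≥ 128`, `4 ≤ L ≤ M`, `L, M` even ⇒ `⟨|L⁻² ∑_x e^{iθ(x,0)}|²⟩ ≥ 1/2`, uniformly in `M ≥ L`
(including `M ≫ L²`). Proof (Fröhlich–Simon–Spencer 1976 / Friedli–Velenik 2017 §10.5, ported to
the anisotropic torus in files I–V): reflection positivity of `⊗ρ` through the planes bisecting the
bonds of either factor gives Gaussian domination (files I–II), hence the infrared bound
`4βε(k,q)⟨|ω̂^a(k,q)|²⟩_w ≤ |Λ|` per mode (file III); the slice sum rule and slice-translation
invariance reduce the defect of slice order to the modes with nonzero SPATIAL momentum (file IV),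
whose Riemann sum is `≤ 32 L²M` uniformly in `M ≥ L` (file V); with `β = K/2` the defect is
`≤ 64/K ≤ 1/2`. The angle/vector dictionary is the tree's `PlaneRotator.*` (Example 10.22), and
`(ℤ/L)² × ℤ/M` is relabelled as `(ℤ/L)² × (ℤ/M)¹`. [cite: FriedliVelenik2017, Thm. 10.24, §10.5.2; FrohlichSimonSpencer1976, Thm. 3.1] -/
theorem birSliceXYOrderRP_proof :
    Summit.HubbardSuperconductivity.HubbardSuperconductivity.Theses.BalabanIR.BirSliceXYOrderRP := by
  refine ⟨128, 4, fun K hK L M _ _ hL4 hLM hLe hMe => ?_⟩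
  dsimp only
  classical
  have hM4 : 4 ≤ M := hL4.trans hLM
  have hL3 : 3 ≤ L := by omega
  have hM3 : 3 ≤ M := by omega
  have hKpos : 0 < K := by linarith
  have hβ : 0 < K / 2 := by linarith
  -- the single-spin law of the plane rotator
  set cs : ℝ → Fin 2 → ℝ := fun t => ![Real.cos t, Real.sin t] with hcs
  have hcsc : Continuous cs := PlaneRotator.continuous_cosSin
  set ρ : Measure (Fin 2 → ℝ) := Measure.map cs (volume.restrict (Set.Icc (0 : ℝ) (2 * Real.pi)))
    with hρ
  obtain ⟨Kc, hKc, hKρ⟩ := PlaneRotator.exists_isCompact_map_angleLaw (ν := 2) hcsc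
  have hρ0 : ρ ≠ 0 := PlaneRotator.map_angleLaw_ne_zero hcsc.measurable
  have hunit : ∀ᵐ s ∂ρ, s 0 ^ 2 + s 1 ^ 2 = 1 :=
    PlaneRotator.ae_map_angleLaw hcsc fun t => by simp [hcs, Real.cos_sq_add_sin_sq]
  -- the relabelling `(ℤ/L)² × ℤ/M ≃ (ℤ/L)² × (ℤ/M)¹`
  set e : ZMod M ≃ TorusSite 1 M := (Equiv.funUnique (Fin 1) (ZMod M)).symm with he
  set eΛ : (TorusSite 2 L × ZMod M) ≃ (TorusSite 2 L × TorusSite 1 M) :=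
    (Equiv.refl (TorusSite 2 L)).prodCongr e with heΛ
  have heΛ1 : ∀ s : TorusSite 2 L × ZMod M, eΛ s = (s.1, e s.2) := fun s => rfl
  have he_add : ∀ t : ZMod M, e (t + 1) = e t + Pi.single 0 1 := by
    intro t; funext i; fin_cases i; simp [he]
  have he0 : e 0 = 0 := by funext i; simp [he]
  -- the objects on the relabelled torus
  set Gr := torusGraph 2 L □ torusGraph 1 M with hGr
  set μ₀ : Measure (TorusSite 2 L × TorusSite 1 M → Fin 2 → ℝ) :=
    Measure.pi fun _ : TorusSite 2 L × TorusSite 1 M => ρ with hμ₀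
  set w : (TorusSite 2 L × TorusSite 1 M → Fin 2 → ℝ) → ℝ := fun ω =>
    Real.exp (-(K / 2) * NVector.vecGradForm (torusGraph 2 L □ torusGraph 1 M) ω ω) with hw
  set sl : (TorusSite 2 L × TorusSite 1 M → Fin 2 → ℝ) → ℝ := fun ω =>
    ‖∑ x : TorusSite 2 L, ((ω (x, 0) 0 : ℂ) + (ω (x, 0) 1 : ℂ) * Complex.I)‖ ^ 2 with hsl
  set EΛ : (TorusSite 2 L × TorusSite 1 M → ℝ) → ℝ := fun θ =>
    ∑ p : TorusSite 2 L × TorusSite 1 M,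
      (Real.cos (θ p - θ (p.1 + ![1, 0], p.2)) + Real.cos (θ p - θ (p.1 + ![0, 1], p.2)) +
        Real.cos (θ p - θ (p.1, p.2 + Pi.single 0 1))) with hEΛ
  set N : ℝ := (L : ℝ) ^ 2 * (M : ℝ) with hN
  set Z₀ : ℝ := ∫ ω, w ω ∂μ₀ with hZ₀
  set I₀ : ℝ := ∫ ω, w ω * sl ω ∂μ₀ with hI₀
  -- Step 1: relabel both angle integrals
  have hrelZ : ∫ θ in Set.pi Set.univ (fun _ : TorusSite 2 L × ZMod M => Set.Icc (0 : ℝ) (2 * Real.pi)),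
      Real.exp (K * ∑ s : TorusSite 2 L × ZMod M, (Real.cos (θ s - θ (s.1 + ![1, 0], s.2)) +
        Real.cos (θ s - θ (s.1 + ![0, 1], s.2)) + Real.cos (θ s - θ (s.1, s.2 + 1)))) =
      ∫ θ in Set.pi Set.univ (fun _ : TorusSite 2 L × TorusSite 1 M => Set.Icc (0 : ℝ) (2 * Real.pi)),
        Real.exp (K * EΛ θ) := by
    rw [← setIntegral_cube_comp eΛ]
    refine setIntegral_congr_fun (MeasurableSet.univ_pi fun _ => measurableSet_Icc) fun θ _ => ?_
    simp only [hEΛ]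
    congr 2
    refine (Fintype.sum_equiv eΛ _ _ fun s => ?_)
    simp only [heΛ1, he_add]
  have hrelN : ∫ θ in Set.pi Set.univ (fun _ : TorusSite 2 L × ZMod M => Set.Icc (0 : ℝ) (2 * Real.pi)),
      ‖∑ x : TorusSite 2 L, Complex.exp (Complex.I * (θ (x, 0) : ℂ))‖ ^ 2 / (L : ℝ) ^ 4 *
        Real.exp (K * ∑ s : TorusSite 2 L × ZMod M, (Real.cos (θ s - θ (s.1 + ![1, 0], s.2)) +
          Real.cos (θ s - θ (s.1 + ![0, 1], s.2)) + Real.cos (θ s - θ (s.1, s.2 + 1)))) =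
      ∫ θ in Set.pi Set.univ (fun _ : TorusSite 2 L × TorusSite 1 M => Set.Icc (0 : ℝ) (2 * Real.pi)),
        ‖∑ x : TorusSite 2 L, Complex.exp (Complex.I * (θ (x, 0) : ℂ))‖ ^ 2 / (L : ℝ) ^ 4 *
          Real.exp (K * EΛ θ) := by
    rw [← setIntegral_cube_comp eΛ]
    refine setIntegral_congr_fun (MeasurableSet.univ_pi fun _ => measurableSet_Icc) fun θ _ => ?_
    simp only [hEΛ, heΛ1, he0]
    congr 3
    refine (Fintype.sum_equiv eΛ _ _ fun s => ?_)
    simp only [heΛ1, he_add]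
  -- Step 2: angles → unit vectors
  have hE : ∀ θ : TorusSite 2 L × TorusSite 1 M → ℝ,
      Real.exp (K * EΛ θ) = Real.exp (3 * N * K) * w (fun p => cs (θ p)) := by
    intro θ
    rw [hw, hcs]
    simp only
    rw [vecGradForm_cosSin_box hL3 hM3 θ, ← Real.exp_add]
    congr 1
    rw [hEΛ, hN]
    ring
  have hO : ∀ θ : TorusSite 2 L × TorusSite 1 M → ℝ,
      ‖∑ x : TorusSite 2 L, Complex.exp (Complex.I * (θ (x, 0) : ℂ))‖ ^ 2 = sl (fun p => cs (θ p)) := by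
    intro θ
    rw [hsl, hcs]
    exact norm_sq_sliceSum_cosSin θ 0
  have hwc : Continuous w :=
    ((NVector.continuous_vecGradForm_self (G := Gr)).const_mul (-(K / 2))).rexp
  have hslc : Continuous sl := by rw [hsl]; fun_prop
  have hZeq : ∫ θ in Set.pi Set.univ (fun _ : TorusSite 2 L × TorusSite 1 M => Set.Icc (0 : ℝ) (2 * Real.pi)),
      Real.exp (K * EΛ θ) = Real.exp (3 * N * K) * Z₀ := by
    simp_rw [hE]
    rw [integral_const_mul, hZ₀, hμ₀, hρ, integral_pi_map_angleLaw hcsc w hwc]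
  have hNeq : ∫ θ in Set.pi Set.univ (fun _ : TorusSite 2 L × TorusSite 1 M => Set.Icc (0 : ℝ) (2 * Real.pi)),
      ‖∑ x : TorusSite 2 L, Complex.exp (Complex.I * (θ (x, 0) : ℂ))‖ ^ 2 / (L : ℝ) ^ 4 *
        Real.exp (K * EΛ θ) = Real.exp (3 * N * K) * I₀ / (L : ℝ) ^ 4 := by
    simp_rw [hE, hO]
    have : ∀ θ : TorusSite 2 L × TorusSite 1 M → ℝ,
        sl (fun p => cs (θ p)) / (L : ℝ) ^ 4 * (Real.exp (3 * N * K) * w (fun p => cs (θ p))) =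
          Real.exp (3 * N * K) / (L : ℝ) ^ 4 * (w (fun p => cs (θ p)) * sl (fun p => cs (θ p))) := by
      intro θ; ring
    simp_rw [this]
    rw [integral_const_mul, hI₀, hμ₀, hρ,
      integral_pi_map_angleLaw hcsc (fun ω => w ω * sl ω) (hwc.mul hslc)]
    ring
  -- Step 3: the infrared bound on the relabelled torus
  have hmain := slice_integral_lower_bound (d := 2) (d' := 1) (L := L) (M := M) hLe hL4 hMe hM4 ρ
    hKc hKρ hρ0 hunit hβ
  have hS := dispersion_sum_bound (L := L) (M := M) hLM
  have hZ₀pos : 0 < Z₀ := by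
    have := NVector.vZ_pos (G := Gr) hρ0 hβ.le (0 : TorusSite 2 L × TorusSite 1 M → Fin 2 → ℝ)
    rwa [NVector.vZ_zero] at this
  have hL0 : (0 : ℝ) < L := by exact_mod_cast (show 0 < L by omega)
  have hM0 : (0 : ℝ) < M := by exact_mod_cast (show 0 < M by omega)
  have hmain' : ((L : ℝ) ^ 2 * (M : ℝ) ^ 1) ^ 2 * Z₀ -
      (L : ℝ) ^ 2 * (M : ℝ) ^ 1 * Z₀ / (K / 2) *
        ∑ k ∈ Finset.univ.erase (0 : TorusSite 2 L), ∑ q : TorusSite 1 M,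
          1 / (dispersion (latticeMomentum L k) + dispersion (latticeMomentum M q)) ≤
      ((M : ℝ) ^ 1) ^ 2 * I₀ := hmain
  simp only [pow_one] at hmain'
  -- Step 4: arithmetic
  rw [hrelZ, hrelN, hZeq, hNeq]
  have hexp : 0 < Real.exp (3 * N * K) := Real.exp_pos _
  rw [le_div_iff₀ (mul_pos hexp hZ₀pos)]
  have hdefect : (L : ℝ) ^ 2 * M * Z₀ / (K / 2) *
      ∑ k ∈ Finset.univ.erase (0 : TorusSite 2 L), ∑ q : TorusSite 1 M,
        1 / (dispersion (latticeMomentum L k) + dispersion (latticeMomentum M q)) ≤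
      ((L : ℝ) ^ 2 * M) ^ 2 * Z₀ / 2 := by
    have h1 : (L : ℝ) ^ 2 * M * Z₀ / (K / 2) *
        ∑ k ∈ Finset.univ.erase (0 : TorusSite 2 L), ∑ q : TorusSite 1 M,
          1 / (dispersion (latticeMomentum L k) + dispersion (latticeMomentum M q)) ≤
        (L : ℝ) ^ 2 * M * Z₀ / (K / 2) * (32 * (L : ℝ) ^ 2 * M) :=
      mul_le_mul_of_nonneg_left hS (by positivity)
    have h2 : (L : ℝ) ^ 2 * M * Z₀ / (K / 2) * (32 * (L : ℝ) ^ 2 * M) =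
        ((L : ℝ) ^ 2 * M) ^ 2 * Z₀ * (64 / K) := by
      field_simp
      ring
    have h3 : 64 / K ≤ 1 / 2 := by
      rw [div_le_div_iff₀ hKpos (by norm_num)]
      linarith
    have h4 : ((L : ℝ) ^ 2 * M) ^ 2 * Z₀ * (64 / K) ≤ ((L : ℝ) ^ 2 * M) ^ 2 * Z₀ * (1 / 2) :=
      mul_le_mul_of_nonneg_left h3 (by positivity)
    linarith
  have hI : ((L : ℝ) ^ 2 * M) ^ 2 * Z₀ / 2 ≤ (M : ℝ) ^ 2 * I₀ := by linarith
  -- `(L²M)² Z₀/2 ≤ M² I₀` ⇒ `Z₀ L⁴/2 ≤ I₀`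
  have hI' : (L : ℝ) ^ 4 * Z₀ / 2 ≤ I₀ := by
    have hM2 : (0 : ℝ) < (M : ℝ) ^ 2 := by positivity
    have : (M : ℝ) ^ 2 * ((L : ℝ) ^ 4 * Z₀ / 2) ≤ (M : ℝ) ^ 2 * I₀ := by nlinarith
    exact le_of_mul_le_mul_left this hM2
  have hL4' : (0 : ℝ) < (L : ℝ) ^ 4 := by positivity
  rw [mul_div_assoc]
  rw [show (1 : ℝ) / 2 * (Real.exp (3 * N * K) * Z₀) = Real.exp (3 * N * K) * (Z₀ / 2) by ring]
  refine mul_le_mul_of_nonneg_left ?_ hexp.le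
  rw [le_div_iff₀ hL4']
  linarith


end Summit.HubbardSuperconductivity.HubbardSuperconductivity.Theorems
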